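import Literature.MathematicalPhysics.QuantumLattice.GrassmannCumulantSeries
import Literature.MathematicalPhysics.QuantumLattice.GrassmannCumulantActionBound
import Literature.MathematicalPhysics.QuantumLattice.GrassmannLaplacianVacuumBound
import Mathlib.Analysis.SpecificLimits.Basic
import HarnessLib

/-!
# The single-scale renormalisation-group step: `‖kernel_m (effAction C V)‖_{1,∞} ≤ ρ^{-m} e‖V‖_h / (1 - θ)`

Topic `Literature/MathematicalPhysics/QuantumLattice`; the assembly of the Laplacian-host engine into ONE statement
(Benfatto–Giuliani–Mastropietro 2006, (2.13)–(2.14) with (2.77)–(2.80); Gawȩdzki–Kupiainen 1985, §3; Gentile–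
Mastropietro 2001, §4).  For an even interaction `V` without constant term on the finite label set `Γ`, a charged
covariance `C` in Gram form on the mixed pairs with constant `κ > 0` and row and column sums of `‖C‖` at most `α > 0`,
pinned `L¹` norms `N(m')` of the kernels of `V` in degree `2m'`, an output field weight `ρ > 0`, the norm
`‖V‖_h = Σ_{m' ≤ |Γ|/2} (e²(κ+ρ))^{2m'} N(m')` and `θ = e α ‖V‖_h / κ²`: IF `θ < 1` THEN the normalised partition
function `∫ dμ_C e^{-V}` is a unit and, in every degree `m ≥ 1`, one output label pinned and the others summed,

`Σ_{W : W_i = w} ‖kernel_m (effAction C V) (W)‖ ≤ ρ^{-m} · e ‖V‖_h / (1 - θ)`   (`sum_norm_kernel_effAction_le`).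

Ingredients: the bound for each cumulant `𝓔ᵀ_C(-V; n)` in degree `m ≥ 1` (`sum_norm_kernel_cumulantOf_le_pow`:
`n! ρ^{-m} κ^{-2(n-1)} α^{n-1} eⁿ ‖V‖_hⁿ = n! ρ^{-m} (κ²/α) θⁿ`) and in degree `0` (`norm_constPart_cumulantOf_le_pow`, volume
`|Γ|`), whence the kernel-wise absolute convergence of `Σ_n 𝓔ᵀ/n!`, and the identification
`kernel (effAction C V) = -Σ_n (n!)⁻¹ kernel 𝓔ᵀ_C(-V; n)` (`kernel_effAction_eq_neg_tsum`).

* `norm_constPart_cumulantOf_le_pow` — the vacuum bound with explicit constants;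
* `normV`, **`sum_norm_kernel_effAction_le`**.

Everything is proved; no named fact.

## Sources

G. Benfatto, A. Giuliani, V. Mastropietro, Ann. Henri Poincaré 7 (2006) 809–898, (2.13)–(2.14), (2.77)–(2.80)
(`BenfattoGiulianiMastropietro2006`); K. Gawȩdzki, A. Kupiainen, Comm. Math. Phys. 102 (1985) 1–30, §3
(`GawedzkiKupiainen1985GrossNeveu`); G. Gentile, V. Mastropietro, Phys. Rep. 352 (2001) 273–437, §4
(`GentileMastropietro2001`).
-/

noncomputable section

namespace Literature.MathematicalPhysics.QuantumLattice

open GrassmannAlgebra Finset Literature.Probability.LatticeModels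
open scoped InnerProductSpace Nat

variable {𝕜 : Type*} [RCLike 𝕜] {Γ : Type*} [Fintype Γ] [DecidableEq Γ] {n : ℕ} (C : Matrix Γ Γ 𝕜)

/-! ### The vacuum bound with explicit constants -/

/-- **`|constPart 𝓔ᵀ_C(V; n)| ≤ |Γ| · n! κ^{-2(n-1)} α^{n-1} eⁿ ‖V‖_hⁿ`.** [cite: BenfattoGiulianiMastropietro2006, (2.77)-(2.80)] -/
theorem norm_constPart_cumulantOf_le_pow {E : Type*} [NormedAddCommGroup E] [InnerProductSpace 𝕜 E]
    (q : Γ → Bool) (hC : ∀ X Y, q X = q Y → C X Y = 0) (f g : Γ → E) {κ : ℝ} (hκ : 0 < κ)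
    (hf : ∀ X, q X = true → ‖f X‖ ≤ κ) (hg : ∀ Y, q Y = false → ‖g Y‖ ≤ κ)
    (hG : ∀ X Y, q X = true → q Y = false → contr 𝕜 C X Y = ⟪f X, g Y⟫_𝕜)
    (degs : Finset ℕ) (K : (m' : ℕ) → (Fin (2 * m') → Γ) → 𝕜) (hK0 : ∀ Y, K 0 Y = 0) (N : ℕ → ℝ) (hN0 : ∀ m', 0 ≤ N m')
    (hN : ∀ m' (j : Fin (2 * m')) (w : Γ), ∑ Y ∈ univ.filter (fun Y : Fin (2 * m') → Γ => Y j = w), ‖K m' Y‖ ≤ N m')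
    {α : ℝ} (hα : 0 < α) (hrow : ∀ X, ∑ Y, ‖C X Y‖ ≤ α) (hcol : ∀ Y, ∑ X, ‖C X Y‖ ≤ α) {ρ : ℝ} (hρ : 0 < ρ) (hn : 0 < n) :
    ‖constPart 𝕜 ((cumulantOf (fun k => evenGaussConv 𝕜 C (vertexOf 𝕜 degs K ^ k)) n : evenPart 𝕜 Γ) : GrassmannAlgebra 𝕜 Γ)‖ ≤
      (Fintype.card Γ : ℝ) * ((n ! : ℝ) * (κ⁻¹ ^ (2 * (n - 1)) * (α ^ (n - 1) * Real.exp n)) *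
        (∑ m' ∈ degs, (Real.exp 2 * (κ + ρ)) ^ (2 * m') * N m') ^ n) := by
  have h := norm_constPart_cumulantOf_le C q hC f g hκ.le hf hg hG degs K hK0 N hN0 hN hα.le hrow hcol
    (fun δ => (α * ((∑ a, (2 * δ a : ℝ)) + n))⁻¹) (fun δ => by positivity) hn
  refine h.trans ?_
  set c : ℝ := κ⁻¹ ^ (2 * (n - 1)) * (((n - 1) ! : ℝ) * α ^ (n - 1) * Real.exp n) with hc
  have hterm : ∀ δ : Fin n → ℕ,
      (if 2 * (n - 1) ≤ ∑ a, 2 * δ a then cumulantBound n κ α ((α * ((∑ a, (2 * δ a : ℝ)) + n))⁻¹) N 0 δ else 0) ≤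
        c * ∏ a, (Real.exp 2 * (κ + ρ)) ^ (2 * δ a) * N (δ a) := by
    intro δ
    have hP : 0 ≤ ∏ a, (Real.exp 2 * (κ + ρ)) ^ (2 * δ a) * N (δ a) := prod_nonneg fun a _ => mul_nonneg (by positivity) (hN0 _)
    split_ifs with hle
    · rw [cumulantBound]
      have hA := choose_mul_pow_le (N := ∑ a, 2 * δ a) (r := 0) (m := 2 * (n - 1)) (by simpa using hle) hκ hρ
      have hT := treeFactor_choice_le hn δ hα
      have hNprod : 0 ≤ ∏ a, N (δ a) := prod_nonneg fun a _ => hN0 _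
      have hTnonneg : 0 ≤ ((α * ((∑ a, (2 * δ a : ℝ)) + n))⁻¹)⁻¹ ^ (n - 1) *
          ∏ ℓ : Sym2 (Fin n), (1 + (α * ((∑ a, (2 * δ a : ℝ)) + n))⁻¹ * (α * (pairDeg (fun a => 2 * δ a) ℓ : ℝ))) := by
        have hs : 0 ≤ ∑ a, (2 * δ a : ℝ) := sum_nonneg fun a _ => by positivity
        exact mul_nonneg (by positivity) (prod_nonneg fun ℓ _ => by positivity)
      calc ((((0 ! : ℝ))⁻¹ * ((∑ a, 2 * δ a).descFactorial 0 : ℝ)) * κ ^ ((∑ a, 2 * δ a) - (0 + 2 * (n - 1))) * ∏ a, N (δ a)) *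
            (((α * ((∑ a, (2 * δ a : ℝ)) + n))⁻¹)⁻¹ ^ (n - 1) *
              ∏ ℓ : Sym2 (Fin n), (1 + (α * ((∑ a, (2 * δ a : ℝ)) + n))⁻¹ * (α * (pairDeg (fun a => 2 * δ a) ℓ : ℝ))))
          ≤ ((ρ⁻¹ ^ 0 * κ⁻¹ ^ (2 * (n - 1)) * (κ + ρ) ^ (∑ a, 2 * δ a)) * ∏ a, N (δ a)) *
              (((n - 1) ! : ℝ) * α ^ (n - 1) * Real.exp (2 * (∑ a, (2 * δ a : ℝ)) + n)) :=
            mul_le_mul (mul_le_mul_of_nonneg_right hA hNprod) hT hTnonneg (by positivity)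
        _ = c * ∏ a, (Real.exp 2 * (κ + ρ)) ^ (2 * δ a) * N (δ a) := by
            have hexp : Real.exp (2 * (∑ a, (2 * δ a : ℝ)) + n) = Real.exp n * ∏ a, Real.exp 2 ^ (2 * δ a) := by
              rw [Real.exp_add, mul_comm, mul_sum, Real.exp_sum]
              congr 1
              refine prod_congr rfl fun a _ => ?_
              rw [← Real.exp_nat_mul]
              congr 1
              push_cast
              ring
            rw [hexp, ← prod_pow_eq_pow_sum, hc, pow_zero, one_mul]
            simp only [mul_pow, prod_mul_distrib]
            ring
    · exact mul_nonneg (by positivity) hP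
  calc ((n : ℝ) * Fintype.card Γ) * ∑ δ ∈ Fintype.piFinset (fun _ : Fin n => degs),
          (if 2 * (n - 1) ≤ ∑ a, 2 * δ a then cumulantBound n κ α ((α * ((∑ a, (2 * δ a : ℝ)) + n))⁻¹) N 0 δ else 0)
      ≤ ((n : ℝ) * Fintype.card Γ) * ∑ δ ∈ Fintype.piFinset (fun _ : Fin n => degs), c * ∏ a, (Real.exp 2 * (κ + ρ)) ^ (2 * δ a) * N (δ a) :=
        mul_le_mul_of_nonneg_left (sum_le_sum fun δ _ => hterm δ) (by positivity)
    _ = (Fintype.card Γ : ℝ) * ((n ! : ℝ) * (κ⁻¹ ^ (2 * (n - 1)) * (α ^ (n - 1) * Real.exp n)) *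
          (∑ m' ∈ degs, (Real.exp 2 * (κ + ρ)) ^ (2 * m') * N m') ^ n) := by
        rw [← mul_sum, sum_piFinset_prod_eq_pow degs fun m' => (Real.exp 2 * (κ + ρ)) ^ (2 * m') * N m', hc,
          ← Nat.mul_factorial_pred (Nat.pos_iff_ne_zero.1 hn), Nat.cast_mul]
        ring

/-! ### The renormalisation-group step -/

/-- The **field-weighted norm** of the kernels of an interaction entering the single-scale step:
`‖V‖_h = Σ_{m' ≤ |Γ|/2} (e²(κ+ρ))^{2m'} N(m')`. [folklore] -/
def normV (Γ : Type*) [Fintype Γ] (κ ρ : ℝ) (N : ℕ → ℝ) : ℝ :=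
  ∑ m' ∈ range (Fintype.card Γ / 2 + 1), (Real.exp 2 * (κ + ρ)) ^ (2 * m') * N m'

omit [DecidableEq Γ] in
/-- `‖V‖_h ≥ 0`. [folklore] -/
theorem normV_nonneg {κ ρ : ℝ} (hκ : 0 ≤ κ) (hρ : 0 ≤ ρ) {N : ℕ → ℝ} (hN : ∀ m', 0 ≤ N m') : 0 ≤ normV Γ κ ρ N :=
  sum_nonneg fun m' _ => mul_nonneg (by positivity) (hN m')

/-- **The single-scale renormalisation-group step** (Benfatto–Giuliani–Mastropietro 2006, (2.13)–(2.14) with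
(2.77)–(2.80); Gawȩdzki–Kupiainen 1985): with `θ = e α ‖V‖_h / κ² < 1`, the normalised partition function is a unit and
`Σ_{W : W_i = w} ‖kernel_m (effAction C V) (W)‖ ≤ ρ^{-m} · e ‖V‖_h / (1 - θ)` in every degree `m ≥ 1`.
[cite: BenfattoGiulianiMastropietro2006, (2.13)-(2.14) and (2.77)-(2.80)] -/
theorem sum_norm_kernel_effAction_le {E : Type*} [NormedAddCommGroup E] [InnerProductSpace 𝕜 E]
    (q : Γ → Bool) (hC : ∀ X Y, q X = q Y → C X Y = 0) (f g : Γ → E) {κ : ℝ} (hκ : 0 < κ)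
    (hf : ∀ X, q X = true → ‖f X‖ ≤ κ) (hg : ∀ Y, q Y = false → ‖g Y‖ ≤ κ)
    (hG : ∀ X Y, q X = true → q Y = false → contr 𝕜 C X Y = ⟪f X, g Y⟫_𝕜)
    (V : GrassmannAlgebra 𝕜 Γ) (hV : V ∈ evenPart 𝕜 Γ) (hV0 : constPart 𝕜 V = 0) (N : ℕ → ℝ) (hN0 : ∀ m', 0 ≤ N m')
    (hN : ∀ m' (j : Fin (2 * m')) (w : Γ), ∑ Y ∈ univ.filter (fun Y : Fin (2 * m') → Γ => Y j = w), ‖kernel 𝕜 V (2 * m') Y‖ ≤ N m')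
    {α : ℝ} (hα : 0 < α) (hrow : ∀ X, ∑ Y, ‖C X Y‖ ≤ α) (hcol : ∀ Y, ∑ X, ‖C X Y‖ ≤ α) {ρ : ℝ} (hρ : 0 < ρ)
    (hθ : Real.exp 1 * α * normV Γ κ ρ N / κ ^ 2 < 1) :
    IsUnit (effPartitionFn 𝕜 C V) ∧ ∀ {m : ℕ}, 0 < m → ∀ (i : Fin m) (w : Γ),
      ∑ W ∈ univ.filter (fun W : Fin m → Γ => W i = w), ‖kernel 𝕜 (effAction 𝕜 C V) m W‖ ≤
        ρ⁻¹ ^ m * (Real.exp 1 * normV Γ κ ρ N) / (1 - Real.exp 1 * α * normV Γ κ ρ N / κ ^ 2) := by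
  -- notation
  set X : evenPart 𝕜 Γ := ⟨-V, neg_mem hV⟩ with hX
  set degs : Finset ℕ := range (Fintype.card Γ / 2 + 1) with hdegs
  set K : (m' : ℕ) → (Fin (2 * m') → Γ) → 𝕜 := fun m' => kernel 𝕜 (-V) (2 * m') with hK
  set nV : ℝ := normV Γ κ ρ N with hnV
  set θ : ℝ := Real.exp 1 * α * nV / κ ^ 2 with hθdef
  have hnV0 : 0 ≤ nV := normV_nonneg hκ.le hρ.le hN0
  have hθ0 : 0 ≤ θ := by positivity
  have hθ1 : θ < 1 := hθ
  have hnVsum : ∑ m' ∈ degs, (Real.exp 2 * (κ + ρ)) ^ (2 * m') * N m' = nV := rfl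
  have hexpn : ∀ k : ℕ, Real.exp k = Real.exp 1 ^ k := fun k => by rw [← Real.exp_nat_mul, mul_one]
  -- `-V` as the `vertexOf` of its kernels
  have hXv : vertexOf 𝕜 degs K = X := Subtype.ext (coe_vertexOf_kernel_eq 𝕜 X)
  have hKnorm : ∀ (m' : ℕ) (Y : Fin (2 * m') → Γ), ‖K m' Y‖ = ‖kernel 𝕜 V (2 * m') Y‖ := by
    intro m' Y
    rw [hK]
    dsimp only
    rw [show -V = (-1 : 𝕜) • V from (neg_one_smul 𝕜 V).symm, kernel_smul, norm_mul, norm_neg, norm_one, one_mul]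
  have hN' : ∀ (m' : ℕ) (j : Fin (2 * m')) (w : Γ), ∑ Y ∈ univ.filter (fun Y : Fin (2 * m') → Γ => Y j = w), ‖K m' Y‖ ≤ N m' := by
    intro m' j w
    simp only [hKnorm]
    exact hN m' j w
  have hK0 : ∀ Y, K 0 Y = 0 := fun Y => by
    rw [hK]
    dsimp only
    rw [kernel_zero, map_neg, hV0, neg_zero]
  -- the cumulants and their bounds
  set κs : ℕ → evenPart 𝕜 Γ := fun n => cumulantOf (fun k => evenGaussConv 𝕜 C (X ^ k)) n with hκs
  have hκs_eq : ∀ n, κs n = cumulantOf (fun k => evenGaussConv 𝕜 C (vertexOf 𝕜 degs K ^ k)) n := fun n => by rw [hXv]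
  have hbd : ∀ {n : ℕ}, 0 < n → ∀ {m : ℕ} (i : Fin m) (w : Γ),
      ∑ W ∈ univ.filter (fun W : Fin m → Γ => W i = w), ‖kernel 𝕜 ((κs n : evenPart 𝕜 Γ) : GrassmannAlgebra 𝕜 Γ) m W‖ ≤
        (n ! : ℝ) * (ρ⁻¹ ^ m * (κ ^ 2 / α) * θ ^ n) := by
    intro n hn m i w
    have h := sum_norm_kernel_cumulantOf_le_pow C q hC f g hκ hf hg hG degs K N hN0 hN' hα hrow hcol hρ hn i w
    rw [← hκs_eq, hnVsum] at h
    refine h.trans (le_of_eq ?_)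
    obtain ⟨n', rfl⟩ : ∃ n', n = n' + 1 := ⟨n - 1, by omega⟩
    rw [hθdef, hexpn, Nat.add_sub_cancel, div_pow, inv_pow, inv_pow]
    field_simp
    ring
  have hbd0 : ∀ {n : ℕ}, 0 < n → ‖constPart 𝕜 ((κs n : evenPart 𝕜 Γ) : GrassmannAlgebra 𝕜 Γ)‖ ≤
      (n ! : ℝ) * ((Fintype.card Γ : ℝ) * (κ ^ 2 / α) * θ ^ n) := by
    intro n hn
    have h := norm_constPart_cumulantOf_le_pow C q hC f g hκ hf hg hG degs K hK0 N hN0 hN' hα hrow hcol hρ hn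
    rw [← hκs_eq, hnVsum] at h
    refine h.trans (le_of_eq ?_)
    obtain ⟨n', rfl⟩ : ∃ n', n = n' + 1 := ⟨n - 1, by omega⟩
    rw [hθdef, hexpn, Nat.add_sub_cancel, div_pow, inv_pow]
    field_simp
    ring
  have hgeom : Summable fun n : ℕ => θ ^ n := summable_geometric_of_lt_one hθ0 hθ1
  -- the kernel series converge absolutely (the hypothesis of the identification)
  have hsum : ∀ (m' : ℕ) (Y : Fin (2 * m') → Γ), Summable fun n : ℕ =>
      ‖kernel 𝕜 ((κs n : evenPart 𝕜 Γ) : GrassmannAlgebra 𝕜 Γ) (2 * m') Y‖ / n ! := by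
    intro m' Y
    rw [← summable_nat_add_iff 1]
    rcases m' with _ | m'
    · refine Summable.of_nonneg_of_le (fun n => by positivity) (fun n => ?_) (hgeom.mul_left ((Fintype.card Γ : ℝ) * (κ ^ 2 / α) * θ))
      have hk : kernel 𝕜 ((κs (n + 1) : evenPart 𝕜 Γ) : GrassmannAlgebra 𝕜 Γ) (2 * 0) Y =
          constPart 𝕜 ((κs (n + 1) : evenPart 𝕜 Γ) : GrassmannAlgebra 𝕜 Γ) := kernel_zero 𝕜 _ Y
      rw [hk, div_le_iff₀ (by positivity)]
      refine (hbd0 (n := n + 1) n.succ_pos).trans (le_of_eq ?_)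
      rw [pow_succ]
      ring
    · refine Summable.of_nonneg_of_le (fun n => by positivity) (fun n => ?_) (hgeom.mul_left (ρ⁻¹ ^ (2 * (m' + 1)) * (κ ^ 2 / α) * θ))
      rw [div_le_iff₀ (by positivity)]
      have hsingle : ‖kernel 𝕜 ((κs (n + 1) : evenPart 𝕜 Γ) : GrassmannAlgebra 𝕜 Γ) (2 * (m' + 1)) Y‖ ≤
          ∑ W ∈ univ.filter (fun W : Fin (2 * (m' + 1)) → Γ => W ⟨0, by omega⟩ = Y ⟨0, by omega⟩),
            ‖kernel 𝕜 ((κs (n + 1) : evenPart 𝕜 Γ) : GrassmannAlgebra 𝕜 Γ) (2 * (m' + 1)) W‖ :=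
        single_le_sum (f := fun W => ‖kernel 𝕜 ((κs (n + 1) : evenPart 𝕜 Γ) : GrassmannAlgebra 𝕜 Γ) (2 * (m' + 1)) W‖)
          (fun W _ => norm_nonneg _) (mem_filter.2 ⟨mem_univ _, rfl⟩)
      refine (hsingle.trans (hbd (n := n + 1) n.succ_pos _ _)).trans (le_of_eq ?_)
      rw [pow_succ]
      ring
  -- the identification
  obtain ⟨hunit, hker⟩ := kernel_effAction_eq_neg_tsum 𝕜 Γ C V hV hV0 hsum
  refine ⟨hunit, @fun m hm i w => ?_⟩
  set a : ℕ → (Fin m → Γ) → 𝕜 := fun n W => if n = 0 then 0 else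
    ((n ! : 𝕜))⁻¹ * kernel 𝕜 ((κs n : evenPart 𝕜 Γ) : GrassmannAlgebra 𝕜 Γ) m W with ha
  have hanorm : ∀ n W, ‖a n W‖ = if n = 0 then 0 else (n ! : ℝ)⁻¹ * ‖kernel 𝕜 ((κs n : evenPart 𝕜 Γ) : GrassmannAlgebra 𝕜 Γ) m W‖ := by
    intro n W
    rw [ha]
    dsimp only
    split_ifs
    · rw [norm_zero]
    · rw [norm_mul, norm_inv, RCLike.norm_natCast]
  -- every term is bounded by the pinned sum over its own fibre
  have haW : ∀ n W, ‖a n W‖ ≤ ρ⁻¹ ^ m * (κ ^ 2 / α) * θ ^ n := by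
    intro n W
    rw [hanorm]
    split_ifs with hn
    · positivity
    · have hsingle : ‖kernel 𝕜 ((κs n : evenPart 𝕜 Γ) : GrassmannAlgebra 𝕜 Γ) m W‖ ≤
          ∑ W' ∈ univ.filter (fun W' : Fin m → Γ => W' i = W i), ‖kernel 𝕜 ((κs n : evenPart 𝕜 Γ) : GrassmannAlgebra 𝕜 Γ) m W'‖ :=
        single_le_sum (f := fun W' => ‖kernel 𝕜 ((κs n : evenPart 𝕜 Γ) : GrassmannAlgebra 𝕜 Γ) m W'‖)
          (fun W' _ => norm_nonneg _) (mem_filter.2 ⟨mem_univ _, rfl⟩)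
      calc (n ! : ℝ)⁻¹ * ‖kernel 𝕜 ((κs n : evenPart 𝕜 Γ) : GrassmannAlgebra 𝕜 Γ) m W‖
          ≤ (n ! : ℝ)⁻¹ * ((n ! : ℝ) * (ρ⁻¹ ^ m * (κ ^ 2 / α) * θ ^ n)) :=
            mul_le_mul_of_nonneg_left (hsingle.trans (hbd (Nat.pos_of_ne_zero hn) i (W i))) (by positivity)
        _ = ρ⁻¹ ^ m * (κ ^ 2 / α) * θ ^ n := by field_simp
  have hsW : ∀ W, Summable fun n => ‖a n W‖ := fun W =>
    Summable.of_nonneg_of_le (fun n => norm_nonneg _) (fun n => haW n W) (hgeom.mul_left _)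
  have hrowbd : ∀ n, ∑ W ∈ univ.filter (fun W : Fin m → Γ => W i = w), ‖a n W‖ ≤ ρ⁻¹ ^ m * (κ ^ 2 / α) * (if n = 0 then 0 else θ ^ n) := by
    intro n
    simp only [hanorm]
    split_ifs with hn
    · rw [sum_const_zero, mul_zero]
    · rw [← mul_sum]
      calc (n ! : ℝ)⁻¹ * ∑ W ∈ univ.filter (fun W : Fin m → Γ => W i = w), ‖kernel 𝕜 ((κs n : evenPart 𝕜 Γ) : GrassmannAlgebra 𝕜 Γ) m W‖
          ≤ (n ! : ℝ)⁻¹ * ((n ! : ℝ) * (ρ⁻¹ ^ m * (κ ^ 2 / α) * θ ^ n)) :=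
            mul_le_mul_of_nonneg_left (hbd (Nat.pos_of_ne_zero hn) i w) (by positivity)
        _ = ρ⁻¹ ^ m * (κ ^ 2 / α) * θ ^ n := by field_simp
  have hgeom' : Summable fun n : ℕ => ρ⁻¹ ^ m * (κ ^ 2 / α) * (if n = 0 then 0 else θ ^ n) := by
    refine (hgeom.mul_left (ρ⁻¹ ^ m * (κ ^ 2 / α))).of_nonneg_of_le (fun n => by positivity) fun n => ?_
    split_ifs
    · rw [mul_zero]; positivity
    · exact le_rfl
  have htsumθ : ∑' n : ℕ, (if n = 0 then (0 : ℝ) else θ ^ n) = θ * (1 - θ)⁻¹ := by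
    have hs : Summable fun n : ℕ => (if n = 0 then (0 : ℝ) else θ ^ n) :=
      hgeom.of_nonneg_of_le (fun n => by positivity) fun n => by
        split_ifs
        · positivity
        · exact le_rfl
    rw [hs.tsum_eq_zero_add]
    simp only [if_true, Nat.succ_ne_zero, if_false, zero_add, pow_succ', tsum_mul_left, tsum_geometric_of_lt_one hθ0 hθ1]
  calc ∑ W ∈ univ.filter (fun W : Fin m → Γ => W i = w), ‖kernel 𝕜 (effAction 𝕜 C V) m W‖
      = ∑ W ∈ univ.filter (fun W : Fin m → Γ => W i = w), ‖∑' n, a n W‖ :=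
        sum_congr rfl fun W _ => by rw [hker hm W, norm_neg]
    _ ≤ ∑ W ∈ univ.filter (fun W : Fin m → Γ => W i = w), ∑' n, ‖a n W‖ :=
        sum_le_sum fun W _ => norm_tsum_le_tsum_norm (hsW W)
    _ = ∑' n, ∑ W ∈ univ.filter (fun W : Fin m → Γ => W i = w), ‖a n W‖ := (Summable.tsum_finsetSum fun W _ => hsW W).symm
    _ ≤ ∑' n, ρ⁻¹ ^ m * (κ ^ 2 / α) * (if n = 0 then 0 else θ ^ n) :=
        Summable.tsum_le_tsum hrowbd (summable_sum fun W _ => hsW W) hgeom'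
    _ = ρ⁻¹ ^ m * (κ ^ 2 / α) * (θ * (1 - θ)⁻¹) := by rw [tsum_mul_left, htsumθ]
    _ = ρ⁻¹ ^ m * (Real.exp 1 * nV) / (1 - θ) := by
        rw [hθdef]
        field_simp

end Literature.MathematicalPhysics.QuantumLattice
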